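import Summits.SmoothPoincare4.SmoothPoincare4.Theses.EntropyRung
import Literature.Geometry.Lorentzian.LeviCivitaProofs
import HarnessLib

/-!
# `SubcylindricalRecognition` — negative knowledge I: shape and load-bearing hypotheses

Support lemmas for crux `stmt-SmoothPoincare4-10869`
(`Summit.SmoothPoincare4.SmoothPoincare4.Theses.EntropyRung.SubcylindricalRecognition`, "RUNG"), from the
standing disprover's work file `Cruxes/SubcylindricalRecognition/Disproof.lean` (§0–§2), landed so that provers /
planners / ideators can import them.

* `Recognition c` — the crux with a generic entropy threshold `c` (`recognition_nuCyl_iff`: `c = ν_cyl` is the crux);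
  `recognition_mono`; `spc4_imp_recognition`, **`spc4_imp : SmoothPoincare4 → SubcylindricalRecognition`** (the crux
  is SPC4-implied: every counterexample is an exotic 4-sphere); `recognition_iff_noExotic` (exotic-free form).
* Load-bearing map: `recognitionWithoutHomotopyEquiv_false` (dropping `M ≃ₕ S⁴` is false as typed, junk witness
  `M = ∅`; the honest variant `ConnectedRecognition` has no known counterexample), `withoutMetric_iff_spc4`
  (dropping all metric hypotheses gives exactly SPC4), `withoutCompact_iff` (the compactness binder is decoration),
  `spc4_imp_withoutPSC`, `spc4_imp_withoutEntropy`, `spc4_imp_recognitionAtLeast` (no hypothesis-side mutation —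
  drop `R > 0`, drop the entropy clause, non-strict `μ ≥ c` without uniform `δ` — is refutable short of ¬SPC4);
  rev 2: `RecognitionFrom H` / `spc4_imp_anyHyp` (SPC4 ⇒ the crux with ANY hypothesis package `H`),
  `recognition_eq_recognitionFrom`.
References: Perelman arXiv:math/0211159 §3; Cao–Hamilton–Ilmanen arXiv:math/0404165 §4 (thresholds).
-/

noncomputable section

set_option linter.dupNamespace false

namespace Summit.SmoothPoincare4.SmoothPoincare4.Theorems.SubcylindricalRecognition.Negative

open scoped Manifold ContDiff Topology ContinuousMap
open MeasureTheory Literature.Geometry.Lorentzian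
open Summit.SmoothPoincare4.SmoothPoincare4.Theses.EntropyRung

/-! ## §0 Vocabulary -/

/-- The standard smooth 4-sphere of the summit statement. -/
local notation "𝕊⁴" => (Metric.sphere (0 : EuclideanSpace ℝ (Fin 5)) 1)

/-- The metric type of the crux: a `C^∞` pseudo-Riemannian metric on `TM`, `M` modelled on `ℝ⁴`. -/
abbrev Metric4 (M : Type) [TopologicalSpace M] [ChartedSpace (EuclideanSpace ℝ (Fin 4)) M]
    [IsManifold (𝓡 4) ∞ M] : Type :=
  PseudoRiemannianMetric (𝓡 4) ∞ (EuclideanSpace ℝ (Fin 4)) (TangentSpace (𝓡 4) : M → Type _)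

section Hyp

variable {M : Type} [TopologicalSpace M] [ChartedSpace (EuclideanSpace ℝ (Fin 4)) M]
  [IsManifold (𝓡 4) ∞ M] [T3Space M] [MeasurableSpace M] [BorelSpace M]

/-- `EntropyAbove g hg c`: the crux's typed form of "ν(g) > c" — a UNIFORM gap δ > 0 below Perelman's
`𝒲(g,f,τ) = ∫ [τ(R + |∇f|²) + f − 4] (4πτ)⁻² e^{−f} dV` over all scales τ > 0 and all smooth `f` with
`∫ (4πτ)⁻² e^{−f} dV = 1`, `dV = riemannianMeasure (g.toContMDiffRiemannianMetric hg)`. For `c = nuCyl` this is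
the entropy hypothesis of `SubcylindricalRecognition` verbatim. -/
def EntropyAbove (g : Metric4 M) [g.HasLeviCivita] (hg : g.IsRiemannian) (c : ℝ) : Prop :=
  ∃ δ : ℝ, 0 < δ ∧ ∀ τ : ℝ, 0 < τ → ∀ f : M → ℝ, ContMDiff (𝓡 4) 𝓘(ℝ, ℝ) ∞ f →
    ∫ x, (4 * Real.pi * τ) ^ (-(4 : ℝ) / 2) * Real.exp (-f x)
        ∂(riemannianMeasure (g.toContMDiffRiemannianMetric hg)) = 1 →
      c + δ ≤ ∫ x, (τ * (g.scalarCurvature x + g.gradSq f x) + f x - 4) *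
        ((4 * Real.pi * τ) ^ (-(4 : ℝ) / 2) * Real.exp (-f x))
          ∂(riemannianMeasure (g.toContMDiffRiemannianMetric hg))

/-- `EntropyAtLeast g hg c`: the NON-STRICT, NON-UNIFORM variant "μ(g,τ) ≥ c for every τ > 0" (no δ). Weaker
hypothesis ⇒ the corresponding recognition statement is STRONGER; it is still SPC4-implied
(`spc4_imp_recognitionAtLeast`), but the MECHANISM dies: with `c = ν_cyl` the round cylinder S³×ℝ
(log Θ = ν_cyl exactly) becomes an admissible tangent flow. -/
def EntropyAtLeast (g : Metric4 M) [g.HasLeviCivita] (hg : g.IsRiemannian) (c : ℝ) : Prop :=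
  ∀ τ : ℝ, 0 < τ → ∀ f : M → ℝ, ContMDiff (𝓡 4) 𝓘(ℝ, ℝ) ∞ f →
    ∫ x, (4 * Real.pi * τ) ^ (-(4 : ℝ) / 2) * Real.exp (-f x)
        ∂(riemannianMeasure (g.toContMDiffRiemannianMetric hg)) = 1 →
      c ≤ ∫ x, (τ * (g.scalarCurvature x + g.gradSq f x) + f x - 4) *
        ((4 * Real.pi * τ) ^ (-(4 : ℝ) / 2) * Real.exp (-f x))
          ∂(riemannianMeasure (g.toContMDiffRiemannianMetric hg))

omit [IsManifold (𝓡 4) ∞ M] in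
/-- The uniform gap implies the non-strict bound (`c + δ ≤ 𝒲` ⇒ `c ≤ 𝒲`). [folklore] -/
theorem EntropyAbove.atLeast [IsManifold (𝓡 4) ∞ M] {g : Metric4 M} [g.HasLeviCivita]
    {hg : g.IsRiemannian} {c : ℝ} (h : EntropyAbove g hg c) : EntropyAtLeast g hg c := by
  obtain ⟨δ, hδ, H⟩ := h
  intro τ hτ f hf h1
  have := H τ hτ f hf h1
  linarith

/-- Lowering the threshold weakens the hypothesis: `EntropyAbove g hg c' → EntropyAbove g hg c` for `c ≤ c'`.
[folklore] -/
theorem EntropyAbove.mono {g : Metric4 M} [g.HasLeviCivita] {hg : g.IsRiemannian} {c c' : ℝ}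
    (hcc' : c ≤ c') (h : EntropyAbove g hg c') : EntropyAbove g hg c := by
  obtain ⟨δ, hδ, H⟩ := h
  exact ⟨δ, hδ, fun τ hτ f hf h1 => le_trans (by linarith) (H τ hτ f hf h1)⟩

end Hyp

/-! ## §1 Shape: generic threshold, SPC4 ⇒ crux, exotic-free form -/

/-- `Recognition c`: the crux with the threshold `ν_cyl` replaced by an arbitrary real `c`
(`Recognition nuCyl` IS the crux, `recognition_nuCyl_iff`). -/
def Recognition (c : ℝ) : Prop :=
  ∀ (M : Type) [TopologicalSpace M] [T2Space M] [SecondCountableTopology M]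
    [ChartedSpace (EuclideanSpace ℝ (Fin 4)) M] [IsManifold (𝓡 4) ∞ M] [CompactSpace M] [T3Space M]
    [MeasurableSpace M] [BorelSpace M],
    M ≃ₕ 𝕊⁴ → ∀ (g : Metric4 M) [g.HasLeviCivita] (hg : g.IsRiemannian),
      (∀ x : M, 0 < g.scalarCurvature x) → EntropyAbove g hg c → Nonempty (M ≃ₘ⟮𝓡 4, 𝓡 4⟯ 𝕊⁴)

/-- `Recognition ν_cyl` is the crux, definitionally (`ν_cyl = log 2 + ½ log π − 3/2`, the crux's literal; it is
`nuCyl` of `Negative/WindowArithmetic.lean`). [folklore] -/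
theorem recognition_nuCyl_iff :
    Recognition (Real.log 2 + Real.log Real.pi / 2 - 3 / 2) ↔ SubcylindricalRecognition := by
  unfold Recognition EntropyAbove SubcylindricalRecognition
  exact Iff.rfl

/-- Raising the threshold weakens the statement: `c ≤ c' → Recognition c → Recognition c'`. So every
`Recognition c`, `c ≤ ν_cyl`, is at least as strong as the crux and every `c ≥ ν_cyl` at most as strong; all of
them are SPC4-implied (`spc4_imp_recognition`). [folklore] -/
theorem recognition_mono {c c' : ℝ} (hcc' : c ≤ c') (h : Recognition c) : Recognition c' := by
  intro M _ _ _ _ _ _ _ _ _ e g _ hg hR hν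
  exact h M e g hg hR (hν.mono hcc')

/-- **SPC4 ⇒ `Recognition c` for every threshold `c`** (one line: the conclusion only depends on `M`).
Consequently no counterexample to any threshold variant exists unless an exotic 4-sphere exists. [folklore] -/
theorem spc4_imp_recognition (h : _root_.SmoothPoincare4) (c : ℝ) : Recognition c := by
  intro M _ _ _ _ _ _ _ _ _ e g _ hg _ _
  exact h M ‹_› ‹_› e

/-- **SPC4 ⇒ the crux.** A refutation of `SubcylindricalRecognition` would refute the summit. [folklore] -/
theorem spc4_imp (h : _root_.SmoothPoincare4) : SubcylindricalRecognition :=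
  recognition_nuCyl_iff.1 (spc4_imp_recognition h _)

/-- `NoSupercylindricalExotic c`: there is no closed smooth `M ≃ₕ S⁴` carrying a Riemannian metric with
`R > 0` and `ν > c` (typed as `EntropyAbove`) that fails to be diffeomorphic to `S⁴`. -/
def NoSupercylindricalExotic (c : ℝ) : Prop :=
  ¬ ∃ (M : Type) (_ : TopologicalSpace M) (_ : T2Space M) (_ : SecondCountableTopology M)
      (_ : ChartedSpace (EuclideanSpace ℝ (Fin 4)) M) (_ : IsManifold (𝓡 4) ∞ M) (_ : CompactSpace M)
      (_ : T3Space M) (_ : MeasurableSpace M) (_ : BorelSpace M) (_ : M ≃ₕ 𝕊⁴) (g : Metric4 M)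
      (_ : g.HasLeviCivita) (hg : g.IsRiemannian),
      (∀ x : M, 0 < g.scalarCurvature x) ∧ EntropyAbove g hg c ∧ IsEmpty (M ≃ₘ⟮𝓡 4, 𝓡 4⟯ 𝕊⁴)

/-- **Exotic-free form.** `Recognition c` ⟺ no super-`c` PSC metric lives on a fake 4-sphere. For `c = ν_cyl`:
the crux is EQUIVALENT to "no exotic S⁴ carries a metric with R > 0 and ν > ν_cyl"; a disproof must exhibit an
exotic S⁴ (and such a metric on it). [folklore] -/
theorem recognition_iff_noExotic (c : ℝ) : Recognition c ↔ NoSupercylindricalExotic c := by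
  constructor
  · intro h hex
    obtain ⟨M, i1, i2, i3, i4, i5, i6, i7, i8, i9, e, g, iLC, hg, hR, hν, hE⟩ := hex
    exact hE.false (h M e g hg hR hν).some
  · intro h M i1 i2 i3 i4 i5 i6 i7 i8 i9 e g iLC hg hR hν
    by_contra hne
    exact h ⟨M, i1, i2, i3, i4, i5, i6, i7, i8, i9, e, g, iLC, hg, hR, hν, not_nonempty_iff.1 hne⟩

/-! ## §2 Load-bearing analysis: drop / weaken one hypothesis at a time -/

/-- RUNG without the homotopy hypothesis `M ≃ₕ S⁴` (everything else verbatim). -/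
def RecognitionWithoutHomotopyEquiv (c : ℝ) : Prop :=
  ∀ (M : Type) [TopologicalSpace M] [T2Space M] [SecondCountableTopology M]
    [ChartedSpace (EuclideanSpace ℝ (Fin 4)) M] [IsManifold (𝓡 4) ∞ M] [CompactSpace M] [T3Space M]
    [MeasurableSpace M] [BorelSpace M],
    ∀ (g : Metric4 M) [g.HasLeviCivita] (hg : g.IsRiemannian),
      (∀ x : M, 0 < g.scalarCurvature x) → EntropyAbove g hg c → Nonempty (M ≃ₘ⟮𝓡 4, 𝓡 4⟯ 𝕊⁴)

/-- The empty type as a (`C^∞`, closed) 4-manifold: empty atlas (a `def`, made a LOCAL instance below, so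
that importing this file does not register instances on `Empty`). -/
@[reducible] def instChartedSpaceEmpty : ChartedSpace (EuclideanSpace ℝ (Fin 4)) Empty where
  atlas := ∅
  chartAt x := x.elim
  mem_chart_source x := x.elim
  chart_mem_atlas x := x.elim

attribute [local instance] instChartedSpaceEmpty

/-- The empty atlas is `C^∞`-compatible. [folklore] -/
theorem instIsManifoldEmpty : IsManifold (𝓡 4) ∞ Empty where
  compatible he _ := (Set.notMem_empty _ he).elim

attribute [local instance] instIsManifoldEmpty

/-- The (unique) metric on the empty 4-manifold. -/
def emptyMetric : Metric4 Empty where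
  val b := b.elim
  symm b := b.elim
  nondegenerate b := b.elim
  contMDiff b := b.elim

/-- **Dropping `M ≃ₕ S⁴` makes the statement FALSE as typed — junk witness `M = ∅`.** On the empty 4-manifold
every hypothesis holds vacuously (`R > 0` at no point; the normalisation `∫ (4πτ)⁻² e^{−f} dV = 1` is never
met because the measure is `0`, so the entropy clause holds with any δ), while `Nonempty (∅ ≃ₘ S⁴)` fails. This is
the ONLY kill found: see `ConnectedRecognition` for the honest variant (no counterexample known).
Classification if it were filed: refuted-misstated (repair: add `M ≃ₕ S⁴`, i.e. the crux itself, or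
`[Nonempty M] [ConnectedSpace M]`). [folklore] -/
theorem recognitionWithoutHomotopyEquiv_false (c : ℝ) : ¬ RecognitionWithoutHomotopyEquiv c := by
  intro h
  letI : MeasurableSpace Empty := borel Empty
  haveI : BorelSpace Empty := ⟨rfl⟩
  haveI := (emptyMetric).hasLeviCivita
  have hg : emptyMetric.IsRiemannian := fun b => b.elim
  have hν : EntropyAbove emptyMetric hg c := ⟨1, one_pos, fun τ _ f _ h1 => by
    rw [Measure.eq_zero_of_isEmpty (riemannianMeasure _), integral_zero_measure] at h1
    exact (zero_ne_one h1).elim⟩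
  obtain ⟨φ⟩ := h Empty emptyMetric hg (fun b => b.elim) hν
  have p : 𝕊⁴ := ⟨EuclideanSpace.single 0 1, by simp⟩
  exact (φ.symm p).elim

/-- The honest `≃ₕ`-free variant: closed CONNECTED non-empty `M⁴` with `R > 0` and `ν > c` is diffeomorphic to
`S⁴`. STATUS (informal, c = ν_cyl): NO counterexample known and plausibly TRUE — every closed non-spherical
model in the 4-d density table is far below the cylinder: ℝP⁴ .406 (= Θ(S⁴)/2), ℂP² .609, S²×S² .541,
Koiso–Cao .518, Page .517, and products/quotients S³×S¹, S²×T², T⁴ have ν = −∞ or ν ≤ ν(S³) + 0 = ν_cyl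
(split lemma); a flow from ν > ν_cyl on any closed M⁴ can (given the two gaps + the compact gap for ALL
topologies) only go extinct roundly. Not SPC4-implied (conclusion no longer guarded by `≃ₕ`), not attacked
further: dropping `≃ₕ` is on no planner's agenda, and ν of an explicit metric is not computable in the tree. -/
def ConnectedRecognition (c : ℝ) : Prop :=
  ∀ (M : Type) [TopologicalSpace M] [T2Space M] [SecondCountableTopology M]
    [ChartedSpace (EuclideanSpace ℝ (Fin 4)) M] [IsManifold (𝓡 4) ∞ M] [CompactSpace M] [T3Space M]
    [MeasurableSpace M] [BorelSpace M] [Nonempty M] [ConnectedSpace M],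
    ∀ (g : Metric4 M) [g.HasLeviCivita] (hg : g.IsRiemannian),
      (∀ x : M, 0 < g.scalarCurvature x) → EntropyAbove g hg c → Nonempty (M ≃ₘ⟮𝓡 4, 𝓡 4⟯ 𝕊⁴)

/-- RUNG without `R > 0`. -/
def RecognitionWithoutPSC (c : ℝ) : Prop :=
  ∀ (M : Type) [TopologicalSpace M] [T2Space M] [SecondCountableTopology M]
    [ChartedSpace (EuclideanSpace ℝ (Fin 4)) M] [IsManifold (𝓡 4) ∞ M] [CompactSpace M] [T3Space M]
    [MeasurableSpace M] [BorelSpace M],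
    M ≃ₕ 𝕊⁴ → ∀ (g : Metric4 M) [g.HasLeviCivita] (hg : g.IsRiemannian),
      EntropyAbove g hg c → Nonempty (M ≃ₘ⟮𝓡 4, 𝓡 4⟯ 𝕊⁴)

/-- RUNG without the entropy hypothesis (= "a PSC metric on a homotopy 4-sphere recognises S⁴"). -/
def RecognitionWithoutEntropy : Prop :=
  ∀ (M : Type) [TopologicalSpace M] [T2Space M] [SecondCountableTopology M]
    [ChartedSpace (EuclideanSpace ℝ (Fin 4)) M] [IsManifold (𝓡 4) ∞ M] [CompactSpace M] [T3Space M]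
    [MeasurableSpace M] [BorelSpace M],
    M ≃ₕ 𝕊⁴ → ∀ (g : Metric4 M) [g.HasLeviCivita] (_hg : g.IsRiemannian),
      (∀ x : M, 0 < g.scalarCurvature x) → Nonempty (M ≃ₘ⟮𝓡 4, 𝓡 4⟯ 𝕊⁴)

/-- RUNG without any metric (= SPC4 over the crux's binder). -/
def RecognitionWithoutMetric : Prop :=
  ∀ (M : Type) [TopologicalSpace M] [T2Space M] [SecondCountableTopology M]
    [ChartedSpace (EuclideanSpace ℝ (Fin 4)) M] [IsManifold (𝓡 4) ∞ M] [CompactSpace M] [T3Space M]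
    [MeasurableSpace M] [BorelSpace M],
    M ≃ₕ 𝕊⁴ → Nonempty (M ≃ₘ⟮𝓡 4, 𝓡 4⟯ 𝕊⁴)

/-- RUNG with the non-strict, non-uniform entropy hypothesis `μ(g,τ) ≥ c ∀ τ` (strongest natural variant on the
entropy side). -/
def RecognitionAtLeast (c : ℝ) : Prop :=
  ∀ (M : Type) [TopologicalSpace M] [T2Space M] [SecondCountableTopology M]
    [ChartedSpace (EuclideanSpace ℝ (Fin 4)) M] [IsManifold (𝓡 4) ∞ M] [CompactSpace M] [T3Space M]
    [MeasurableSpace M] [BorelSpace M],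
    M ≃ₕ 𝕊⁴ → ∀ (g : Metric4 M) [g.HasLeviCivita] (hg : g.IsRiemannian),
      (∀ x : M, 0 < g.scalarCurvature x) → EntropyAtLeast g hg c → Nonempty (M ≃ₘ⟮𝓡 4, 𝓡 4⟯ 𝕊⁴)

/-- Strength ordering: no metric ⇒ no entropy ⇒ crux-shape. [folklore] -/
theorem withoutMetric_imp_withoutEntropy (h : RecognitionWithoutMetric) : RecognitionWithoutEntropy :=
  fun M _ _ _ _ _ _ _ _ _ e _ _ _ _ => h M e

/-- [folklore] -/
theorem withoutEntropy_imp_recognition (h : RecognitionWithoutEntropy) (c : ℝ) : Recognition c :=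
  fun M _ _ _ _ _ _ _ _ _ e g _ hg hR _ => h M e g hg hR

/-- [folklore] -/
theorem withoutPSC_imp_recognition {c : ℝ} (h : RecognitionWithoutPSC c) : Recognition c :=
  fun M _ _ _ _ _ _ _ _ _ e g _ hg _ hν => h M e g hg hν

/-- [folklore] -/
theorem recognitionAtLeast_imp_recognition {c : ℝ} (h : RecognitionAtLeast c) : Recognition c :=
  fun M _ _ _ _ _ _ _ _ _ e g _ hg hR hν => h M e g hg hR hν.atLeast

/-- **Dropping every metric hypothesis gives exactly SPC4** (the extra binders `CompactSpace`, `T3Space`,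
`MeasurableSpace`, `BorelSpace` of the crux are dischargeable from `M ≃ₕ S⁴`: Hatcher 3.29 in the tree, compact
T₂ ⇒ T₃, Borel σ-algebra). So the metric hypotheses are the WHOLE content of the crux relative to the summit.
[folklore] -/
theorem withoutMetric_iff_spc4 : RecognitionWithoutMetric ↔ _root_.SmoothPoincare4 := by
  constructor
  · intro h M _ _ _ _ _ e
    haveI : CompactSpace M :=
      Literature.Topology.FourManifolds.compactSpace_of_homotopyEquiv_sphere_four_holds M e
    letI : MeasurableSpace M := borel M
    haveI : BorelSpace M := ⟨rfl⟩
    exact h M e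
  · intro h M _ _ _ _ _ _ _ _ _ e
    exact h M ‹_› ‹_› e

/-- SPC4 ⇒ RUNG-without-`R>0`: the PSC hypothesis cannot be shown necessary by a counterexample. [folklore] -/
theorem spc4_imp_withoutPSC (h : _root_.SmoothPoincare4) (c : ℝ) : RecognitionWithoutPSC c :=
  fun M _ _ _ _ _ _ _ _ _ e _ _ _ _ => h M ‹_› ‹_› e

/-- SPC4 ⇒ RUNG-without-entropy. [folklore] -/
theorem spc4_imp_withoutEntropy (h : _root_.SmoothPoincare4) : RecognitionWithoutEntropy :=
  withoutMetric_imp_withoutEntropy (withoutMetric_iff_spc4.2 h)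

/-- SPC4 ⇒ the non-strict variant. [folklore] -/
theorem spc4_imp_recognitionAtLeast (h : _root_.SmoothPoincare4) (c : ℝ) : RecognitionAtLeast c :=
  fun M _ _ _ _ _ _ _ _ _ e _ _ _ _ _ => h M ‹_› ‹_› e

/-- RUNG without the `[CompactSpace M]` binder. -/
def RecognitionWithoutCompact (c : ℝ) : Prop :=
  ∀ (M : Type) [TopologicalSpace M] [T2Space M] [SecondCountableTopology M]
    [ChartedSpace (EuclideanSpace ℝ (Fin 4)) M] [IsManifold (𝓡 4) ∞ M] [T3Space M]
    [MeasurableSpace M] [BorelSpace M],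
    M ≃ₕ 𝕊⁴ → ∀ (g : Metric4 M) [g.HasLeviCivita] (hg : g.IsRiemannian),
      (∀ x : M, 0 < g.scalarCurvature x) → EntropyAbove g hg c → Nonempty (M ≃ₘ⟮𝓡 4, 𝓡 4⟯ 𝕊⁴)

/-- The compactness binder is decoration (it follows from `M ≃ₕ S⁴`, Hatcher 3.29 in the tree). [folklore] -/
theorem withoutCompact_iff (c : ℝ) : RecognitionWithoutCompact c ↔ Recognition c := by
  constructor
  · intro h M _ _ _ _ _ _ _ _ _ e g _ hg hR hν
    exact h M e g hg hR hν
  · intro h M _ _ _ _ _ _ _ _ e g _ hg hR hν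
    haveI : CompactSpace M :=
      Literature.Topology.FourManifolds.compactSpace_of_homotopyEquiv_sphere_four_holds M e
    exact h M e g hg hR hν


/-! ## Generic "any hypothesis package" form -/

/-- A hypothesis package over the crux's binder (any `Prop` depending on `M` and its ten instances). -/
abbrev HypPack : Type 1 :=
  ∀ (M : Type) [TopologicalSpace M] [T2Space M] [SecondCountableTopology M]
    [ChartedSpace (EuclideanSpace ℝ (Fin 4)) M] [IsManifold (𝓡 4) ∞ M] [CompactSpace M] [T3Space M]
    [MeasurableSpace M] [BorelSpace M], Prop

/-- `RecognitionFrom H`: "`M ≃ₕ S⁴` and `H M` ⇒ `M ≅ S⁴`" — the crux with its metric hypotheses replaced by an ARBITRARY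
package `H` (any strengthening / weakening of `R > 0 ∧ ν > c`, curvature pinching, stability clauses, …). -/
def RecognitionFrom (H : HypPack) : Prop :=
  ∀ (M : Type) [TopologicalSpace M] [T2Space M] [SecondCountableTopology M]
    [ChartedSpace (EuclideanSpace ℝ (Fin 4)) M] [IsManifold (𝓡 4) ∞ M] [CompactSpace M] [T3Space M]
    [MeasurableSpace M] [BorelSpace M],
    M ≃ₕ 𝕊⁴ → H M → Nonempty (M ≃ₘ⟮𝓡 4, 𝓡 4⟯ 𝕊⁴)

/-- **SPC4 ⇒ `RecognitionFrom H` for EVERY hypothesis package `H`**: no mutation on the hypothesis side of the crux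
(keeping `M ≃ₕ S⁴ → … → M ≅ S⁴`) is refutable short of exhibiting an exotic 4-sphere — the licence the crux lines
(`entropy-ratchet`, `stable-window-genericity`) use to move `g` freely. [folklore] -/
theorem spc4_imp_anyHyp (h : _root_.SmoothPoincare4) (H : HypPack) : RecognitionFrom H :=
  fun M _ _ _ _ _ _ _ _ _ e _ => h M ‹_› ‹_› e

/-- `Recognition c` is `RecognitionFrom` of its own metric package. [folklore] -/
theorem recognition_eq_recognitionFrom (c : ℝ) :
    Recognition c ↔ RecognitionFrom (fun M _ _ _ _ _ _ _ _ _ =>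
      ∃ (g : Metric4 M) (_ : g.HasLeviCivita) (hg : g.IsRiemannian),
        (∀ x : M, 0 < g.scalarCurvature x) ∧ EntropyAbove g hg c) := by
  constructor
  · rintro h M _ _ _ _ _ _ _ _ _ e ⟨g, iLC, hg, hR, hν⟩
    exact h M e g hg hR hν
  · intro h M _ _ _ _ _ _ _ _ _ e g iLC hg hR hν
    exact h M e ⟨g, iLC, hg, hR, hν⟩

end Summit.SmoothPoincare4.SmoothPoincare4.Theorems.SubcylindricalRecognition.Negative

end
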